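import Mathlib.Analysis.SpecialFunctions.Integrals.Basic
import Literature.NumberTheory.Transcendental.KZLogCalculusProofs
import Literature.NumberTheory.Transcendental.KZDominatedFamilyRelations
import Literature.NumberTheory.Transcendental.KZBallPeelingAux
import Summits.KontsevichZagierPeriods.KontsevichZagierPeriods.Theorems.TerasomaMultiplicationBetaCancellationStubAffineMove
import Summits.KontsevichZagierPeriods.KontsevichZagierPeriods.Theorems.NormalFormPrinciple.Negative.WindowInvariant

/-!
# `NormalFormPrinciple` (stmt-KontsevichZagierPeriods-3869), line `SketchIdeator1` — the leaf
# `stub_boxRigidity` on its lowest layer, I: the dlog representations and their moves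

The line `SketchIdeator1` is closed modulo its declared residual `BoxRigidity ∧ KZ.PiCancellation`
(`Theorems/HurwitzMicroSectorsNormalFormPrinciplePiBoxTransfer.lean`, `…PiBoxResidual.lean`). This
pure proof file (lead seat c3; `--supports` the crux) and its sequels `…DlogCarriers.lean`,
`…DlogLattice.lean` prove the residual on the first non-trivial sub-family of dimension one —
the **dlog representations** `[(a, b), c/y]` (`a, b, c ∈ ℚ`, `0 < a`), of value `c · log (b/a)` —
UNCONDITIONALLY and with unique factorisation as the only arithmetic input. Here: existence
(`exists_dlog`), the value (`value_dlog`), and the four moves of the engine inside `KZ.relations`: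

* congruence / zero integrand / empty slab (rule 1);
* **merging** (rule 1b) `[σ, (c+c')/y] ≡ [σ, c/y] + [σ, c'/y]` (`dlog_merge_mem_relations`);
* **splitting** (rule 1a and a null point) `[(a,b'), f] ≡ [(a,b), f] + [(b,b'), f]`
  (`split_mem_relations`);
* **scaling** (rule 2, the dilation `y ↦ s y`, Jacobian `s`) `[(a,b), c/y] ≡ [(sa,sb), c/y]`
  (`dlog_scale_mem_relations`).

Sources: M. Kontsevich, D. Zagier, *Periods* (2001), §1.1 (`log 2 = ∫₁² dx/x`), §1.2 rules (1), (2).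
The affine chart lemmas are those of `TerasomaMultiplicationBetaCancellationStubAffineMove.lean`,
the transfer lemmas `ℝ¹ ↔ ℝ` those of `NormalFormPrinciple/Negative/WindowInvariant.lean`; no
definitions are introduced (representations are quantified with their domain and integrand).
-/

noncomputable section

open MeasureTheory Set Finset
open Literature.NumberTheory.Transcendental Literature.NumberTheory.Transcendental.KZ
open Literature.ModelTheory.ExponentialFields (IsSemialgebraic)

namespace Summit.KontsevichZagierPeriods.HurwitzMicroSectors.NormalFormPrinciple.PiBox

namespace Dlog

open Literature.NumberTheory.Transcendental.KZ.BallPeeling (isSemialgebraic_Ioo₁)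
open Summit.KontsevichZagierPeriods.KontsevichZagierPeriods.BetaCancellationLine
  (aff_hasFDerivAt_chart aff_abs_det_chartDeriv aff_injective_chart aff_isSemialgebraicMapOn_chart)
open Summit.KontsevichZagierPeriods.HurwitzMicroSectors.NormalFormPrinciple.Negative
  (setIntegral_fin_one integrableOn_fin_one)

/-! ## Intervals of `ℝ¹` -/

/-- The volume of an interval slab of `ℝ¹` is the length of the interval. [folklore] -/
theorem volume_slab (T : Set ℝ) : volume {z : Fin 1 → ℝ | z 0 ∈ T} = volume T := by
  have hmp := MeasureTheory.volume_preserving_funUnique (Fin 1) ℝ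
  have hpre : {z : Fin 1 → ℝ | z 0 ∈ T} = MeasurableEquiv.funUnique (Fin 1) ℝ ⁻¹' T := by
    ext x; simp [MeasurableEquiv.funUnique, Fin.default_eq_zero]
  rw [hpre, ← hmp.map_eq]
  exact (MeasurableEquiv.map_apply _ T).symm

/-- A one-point slab of `ℝ¹` is null. [folklore] -/
theorem volume_slab_singleton (b : ℝ) : volume {z : Fin 1 → ℝ | z 0 ∈ ({b} : Set ℝ)} = 0 := by
  rw [volume_slab, Real.volume_singleton]

/-! ## The dlog representations `[(a,b), c/y]` -/

/-- **Existence of the dlog representation** `[(a,b), c/y]` for rationals `a, b, c` with `0 < a`: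
domain the open slab `{a < y < b} ⊂ ℝ¹`, integrand `c/y` (KZ-literal data `C c / X₀`).
[cite: KontsevichZagier2001, §1.1] -/
theorem exists_dlog (a b c : ℚ) (ha : 0 < a) :
    ∃ L : IntegralRep 1, L.domain = {x | x 0 ∈ Set.Ioo (a:ℝ) b} ∧
      L.integrand = fun x => (c:ℝ) / x 0 := by
  have hpos : ∀ x ∈ {x : Fin 1 → ℝ | x 0 ∈ Set.Ioo (a:ℝ) b}, 0 < x 0 := fun x hx =>
    lt_trans (by exact_mod_cast ha) hx.1
  have hsa : IsSemialgebraicFunOn ℚ {x : Fin 1 → ℝ | x 0 ∈ Set.Ioo (a:ℝ) b}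
      (fun x => (c:ℝ) / x 0) := by
    refine (isSemialgebraicFunOn_aeval_div_aeval (isSemialgebraic_Ioo₁ a b)
      (MvPolynomial.C c : MvPolynomial (Fin 1) ℚ) (MvPolynomial.X 0) fun x hx => ?_).congr
      fun x _ => ?_
    · simp only [MvPolynomial.aeval_X]
      exact (hpos x hx).ne'
    · simp only [MvPolynomial.aeval_X, MvPolynomial.aeval_C, eq_ratCast]
  have hint : IntegrableOn (fun x : Fin 1 → ℝ => (c:ℝ) / x 0)
      {x : Fin 1 → ℝ | x 0 ∈ Set.Ioo (a:ℝ) b} := by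
    rw [integrableOn_fin_one]
    have hc : ContinuousOn (fun t : ℝ => (c:ℝ) / t) (Set.Icc (a:ℝ) b) :=
      continuousOn_const.div continuousOn_id fun t ht =>
        (lt_of_lt_of_le (by exact_mod_cast ha) ht.1).ne'
    exact (hc.integrableOn_compact isCompact_Icc).mono_set Set.Ioo_subset_Icc_self
  exact ⟨⟨{x | x 0 ∈ Set.Ioo (a:ℝ) b}, fun x => (c:ℝ) / x 0, isSemialgebraic_Ioo₁ a b, hsa, hint⟩,
    rfl, rfl⟩

/-- **Value of a dlog representation**: `∫_{(a,b)} c/y dy = c · log (b/a)` for `0 < a ≤ b`.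
[cite: KontsevichZagier2001, §1.1] -/
theorem value_dlog {a b c : ℚ} (L : IntegralRep 1) (hd : L.domain = {x | x 0 ∈ Set.Ioo (a:ℝ) b})
    (hi : EqOn L.integrand (fun x => (c:ℝ) / x 0) L.domain) (ha : 0 < a) (hab : a ≤ b) :
    L.value = c * Real.log ((b:ℝ) / a) := by
  have ha' : (0:ℝ) < a := by exact_mod_cast ha
  have hab' : (a:ℝ) ≤ b := by exact_mod_cast hab
  rw [IntegralRep.value, setIntegral_congr_fun (IsSemialgebraic.measurableSet_holds
    L.isSemialgebraic_domain) hi, hd, setIntegral_fin_one (fun x => (c:ℝ) / x 0) (Set.Ioo (a:ℝ) b)]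
  simp only
  rw [← integral_Ioc_eq_integral_Ioo, ← intervalIntegral.integral_of_le hab']
  have : (fun t : ℝ => (c:ℝ) / t) = fun t => (c:ℝ) * t⁻¹ := by
    funext t; rw [div_eq_mul_inv]
  rw [this, intervalIntegral.integral_const_mul, integral_inv_of_pos ha' (lt_of_lt_of_le ha' hab')]

/-! ## The moves -/

/-- **Congruence**: two representations on the same slab with integrands `c/y` differ by a
relation. [cite: KontsevichZagier2001, §1.2 rule (1)] -/
theorem dlog_congr_mem_relations {σ : Set (Fin 1 → ℝ)} {c : ℚ} (L L' : IntegralRep 1)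
    (hd : L.domain = σ) (hd' : L'.domain = σ)
    (hi : EqOn L.integrand (fun x => (c:ℝ) / x 0) L.domain)
    (hi' : EqOn L'.integrand (fun x => (c:ℝ) / x 0) L'.domain) :
    of L - of L' ∈ relations :=
  of_sub_of_mem_relations_of_eqOn (hd'.trans hd.symm) fun x hx => by
    rw [hi hx, hi' (by rw [hd', ← hd]; exact hx)]

/-- **Zero integrand**: `[(a,b), 0/y] ∈ relations`. [cite: KontsevichZagier2001, §1.2 rule (1)] -/
theorem dlog_zero_mem_relations (L : IntegralRep 1)
    (hi : EqOn L.integrand (fun x => ((0:ℚ):ℝ) / x 0) L.domain) : of L ∈ relations :=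
  of_mem_relations_of_eqOn_zero L fun x hx => by simp [hi hx]

/-- **Empty slab**: a representation on `{a < y < b}` with `b ≤ a` is a relation (null domain).
[cite: KontsevichZagier2001, §1.2 rule (1)] -/
theorem slab_empty_mem_relations {a b : ℝ} (L : IntegralRep 1)
    (hd : L.domain = {x | x 0 ∈ Set.Ioo a b}) (hba : b ≤ a) : of L ∈ relations := by
  refine of_mem_relations_of_volume_eq_zero L ?_
  rw [hd, Set.Ioo_eq_empty (not_lt.mpr hba)]
  simp

/-- **Merging** (rule 1b): `[(σ), (c+c')/y] − [σ, c/y] − [σ, c'/y] ∈ relations`.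
[cite: KontsevichZagier2001, §1.2 rule (1)] -/
theorem dlog_merge_mem_relations {σ : Set (Fin 1 → ℝ)} {c c' : ℚ} (L L₁ L₂ : IntegralRep 1)
    (hd : L.domain = σ) (hd₁ : L₁.domain = σ) (hd₂ : L₂.domain = σ)
    (hi : EqOn L.integrand (fun x => ((c + c' : ℚ):ℝ) / x 0) L.domain)
    (hi₁ : EqOn L₁.integrand (fun x => (c:ℝ) / x 0) L₁.domain)
    (hi₂ : EqOn L₂.integrand (fun x => (c':ℝ) / x 0) L₂.domain) :
    of L - of L₁ - of L₂ ∈ relations := by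
  refine integrandAddRel_subset_relations ⟨1, L, L₁, L₂, hd₁.trans hd.symm, hd₂.trans hd.symm,
    fun x hx => ?_, rfl⟩
  rw [Pi.add_apply, hi hx, hi₁ (by rw [hd₁, ← hd]; exact hx), hi₂ (by rw [hd₂, ← hd]; exact hx)]
  push_cast
  ring

/-- **Splitting** (rule 1a, plus a null point): for `a ≤ b ≤ b'` and one integrand `f`,
`[(a,b'), f] − [(a,b), f] − [(b,b'), f] ∈ relations`. [cite: KontsevichZagier2001, §1.2 rule (1)] -/
theorem split_mem_relations {a b b' : ℝ} (L L₁ L₂ : IntegralRep 1)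
    (hd : L.domain = {x | x 0 ∈ Set.Ioo a b'}) (hd₁ : L₁.domain = {x | x 0 ∈ Set.Ioo a b})
    (hd₂ : L₂.domain = {x | x 0 ∈ Set.Ioo b b'}) (hab : a ≤ b) (hbb' : b ≤ b')
    (hi₁ : EqOn L₁.integrand L.integrand L₁.domain) (hi₂ : EqOn L₂.integrand L.integrand L₂.domain) :
    of L - of L₁ - of L₂ ∈ relations := by
  -- remove the point `b`
  set E : Set (Fin 1 → ℝ) := {x | x 0 ∈ Set.Ioo a b} ∪ {x | x 0 ∈ Set.Ioo b b'} with hE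
  have hEsa : IsSemialgebraic ℚ E := by
    have := L₁.isSemialgebraic_domain.union L₂.isSemialgebraic_domain
    rwa [hd₁, hd₂] at this
  have hEsub : E ⊆ L.domain := by
    rw [hd]
    rintro x (hx | hx)
    · exact ⟨hx.1, lt_of_lt_of_le hx.2 hbb'⟩
    · exact ⟨lt_of_le_of_lt hab hx.1, hx.2⟩
  have hnull : volume (L.domain \ E) = 0 := by
    refine measure_mono_null (fun x hx => ?_) (volume_slab_singleton b)
    rw [hd] at hx
    obtain ⟨⟨h1, h2⟩, hx'⟩ := hx
    simp only [hE, Set.mem_union, Set.mem_setOf_eq, Set.mem_Ioo, not_or, not_and, not_lt] at hx'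
    obtain ⟨h3, h4⟩ := hx'
    show x 0 ∈ ({b} : Set ℝ)
    have hb1 : b ≤ x 0 := h3 h1
    have hb2 : x 0 ≤ b := by
      by_contra hlt
      exact absurd (h4 (not_le.mp hlt)) (not_le.mpr h2)
    exact le_antisymm hb2 hb1
  have h0 : of L - of (L.restrict E hEsa hEsub) ∈ relations :=
    L.of_sub_of_restrict_mem_relations hEsa hEsub hnull
  -- domain additivity on `E = (a,b) ∪ (b,b')`
  have h1 : of (L.restrict E hEsa hEsub) - of L₁ - of L₂ ∈ relations := by
    refine domainAddRel_subset_relations ⟨1, L.restrict E hEsa hEsub, L₁, L₂, ?_, ?_,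
      fun x hx => (hi₁ hx).symm, fun x hx => (hi₂ hx).symm, rfl⟩
    · rw [IntegralRep.domain_restrict, hd₁, hd₂]
    · rw [hd₁, hd₂]
      have : {x : Fin 1 → ℝ | x 0 ∈ Set.Ioo a b} ∩ {x | x 0 ∈ Set.Ioo b b'} = ∅ := by
        ext x
        simp only [Set.mem_inter_iff, Set.mem_setOf_eq, Set.mem_Ioo, Set.mem_empty_iff_false,
          iff_false, not_and, not_lt]
        intro h h'
        exact absurd (h.2.trans h') (lt_irrefl _)
      rw [this, measure_empty]
  have : of L - of L₁ - of L₂ = (of L - of (L.restrict E hEsa hEsub)) +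
      (of (L.restrict E hEsa hEsub) - of L₁ - of L₂) := by abel
  rw [this]
  exact relations.add_mem h0 h1

/-- The image of a slab under the dilation `y ↦ s·y` (`0 < s`). [folklore] -/
theorem image_smul_slab {s : ℝ} (hs : 0 < s) (a b : ℝ) :
    (fun y : Fin 1 → ℝ => fun _ : Fin 1 => s * y 0 + 0) '' {x : Fin 1 → ℝ | x 0 ∈ Set.Ioo a b} =
      {x : Fin 1 → ℝ | x 0 ∈ Set.Ioo (s * a) (s * b)} := by
  ext y
  constructor
  · rintro ⟨x, hx, rfl⟩
    simp only [Set.mem_setOf_eq, Set.mem_Ioo, add_zero] at hx ⊢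
    exact ⟨mul_lt_mul_of_pos_left hx.1 hs, mul_lt_mul_of_pos_left hx.2 hs⟩
  · intro hy
    simp only [Set.mem_setOf_eq, Set.mem_Ioo] at hy
    refine ⟨fun _ => y 0 / s, ?_, ?_⟩
    · simp only [Set.mem_setOf_eq, Set.mem_Ioo]
      rw [lt_div_iff₀ hs, div_lt_iff₀ hs]
      constructor <;> nlinarith [hy.1, hy.2]
    · funext i
      obtain rfl : i = 0 := Fin.fin_one_eq_zero i
      field_simp
      ring

/-- **Scaling** (rule 2): for rational `s > 0` and `0 < a`, `[(a,b), c/y] − [(sa, sb), c/y] ∈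
relations` — the dilation `y ↦ s·y` has Jacobian `s` and `c/y = (c/(s y))·s`.
[cite: KontsevichZagier2001, §1.2 rule (2)] -/
theorem dlog_scale_mem_relations {a b c s : ℚ} (L L' : IntegralRep 1)
    (hd : L.domain = {x | x 0 ∈ Set.Ioo (a:ℝ) b})
    (hd' : L'.domain = {x | x 0 ∈ Set.Ioo ((s * a : ℚ):ℝ) ((s * b : ℚ):ℝ)})
    (hi : EqOn L.integrand (fun x => (c:ℝ) / x 0) L.domain)
    (hi' : EqOn L'.integrand (fun x => (c:ℝ) / x 0) L'.domain) (ha : 0 < a) (hs : 0 < s) :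
    of L - of L' ∈ relations := by
  have hs' : (0:ℝ) < s := by exact_mod_cast hs
  have himage : L'.domain = (fun y : Fin 1 → ℝ => fun _ : Fin 1 => (s:ℝ) * y 0 + 0) '' L.domain := by
    rw [hd, image_smul_slab hs', hd']
    push_cast
    rfl
  refine changeOfVariablesRel_subset_relations
    ⟨1, L, L', fun y : Fin 1 → ℝ => fun _ : Fin 1 => (s:ℝ) * y 0 + 0,
      fun _ => (s:ℝ) • ContinuousLinearMap.id ℝ (Fin 1 → ℝ),
      aff_isSemialgebraicMapOn_chart L.isSemialgebraic_domain isAlgebraic_zero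
        (isAlgebraic_algebraMap s),
      fun x _ => (aff_hasFDerivAt_chart (s:ℝ) 0 x).hasFDerivWithinAt,
      (aff_injective_chart hs'.ne' 0).injOn, himage, fun x hx => ?_, rfl⟩
  have hΦx : (fun _ : Fin 1 => (s:ℝ) * x 0 + 0) ∈ L'.domain := himage ▸ Set.mem_image_of_mem _ hx
  have hx0 : (0:ℝ) < x 0 := by
    rw [hd] at hx
    exact lt_trans (by exact_mod_cast ha) hx.1
  rw [hi hx, hi' hΦx, aff_abs_det_chartDeriv hs']
  simp only [add_zero]
  field_simp

end Dlog

end Summit.KontsevichZagierPeriods.HurwitzMicroSectors.NormalFormPrinciple.PiBox
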